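import Literature.Probability.Percolation.QuadCrossingQuadPaths
import HarnessLib

/-!
# The region below a transversal continuum of a quad (the set `M` of the lowest-crossing argument)

Topic `Probability/Percolation`; proofs file towards Schramm–Smirnov's continuity Lemma 6.1
(`SchrammSmirnov2011_lemma_6_1`, file `QuadCrossingContinuity.lean`; O. Schramm, S. Smirnov, *On the
scaling limits of planar percolation*, Ann. Probab. 39 (2011), arXiv:1101.5820, §6, p. 22: "Let `M`
be the connected component of `[Q'] ∖ γ` which has `∂₁Q'` on its boundary.  The event `¬⊞_Q` would
imply that `γ` cannot be connected to `∂₂Q` by a crossing inside `[Q] ∖ M`.  Hence, there is a dual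
closed crossing from `∂₃Q` to `(σ₃ ∩ M̄) ∪ ∂₁Q`, in particular crossing the annulus `A(x, δ, d₁/2)`
inside `[Q] ∖ M`").

For a GENERAL quad the lowest crossing `γ` may touch `∂Q'` away from its ends, so "the component
containing `∂₁Q'`" is not robust; we use instead, for any closed set `W ⊆ [Q]` (in the application
`W = γ ∪ α`, the lowest crossing followed by its short junction to `∂₂Q`, a continuum meeting `∂₀Q`
and `∂₂Q`), the **region below `W`**:
`M_W = {z ∈ [Q] : every path in [Q] from z to ∂₃Q meets W}` (written out; no definition is
introduced).  This file proves its basic topology and the deterministic half of the quoted step: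

* `Quad.side_one_subset_below` — `∂₁Q ⊆ M_W` when `W` is a continuum meeting `∂₀Q` and `∂₂Q`
  (crossing lemma `Quad.exists_mem_of_isPreconnected_crossing`);
* `Quad.subset_below` — `W ∩ [Q] ⊆ M_W`; `Quad.not_mem_below_of_path_avoiding` — a point joined to
  `∂₃Q` off `W` is not in `M_W`;
* `Quad.isClosed_below`, `Quad.mem_of_mem_below_of_mem_closure` — `M_W` is closed and its boundary
  relative to `[Q]` lies in `W` (both by the short junctions of `Quad.exists_short_path`);
* `Quad.exists_final_segment_avoiding_below` — **the dual crossing after its last visit to `M̄`**: a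
  path in `[Q]` from a point of `M_W` to a point of `∂₃Q ∖ M_W` has a last time in `M_W`, at which it
  is on `W`, and after which it avoids `M_W`.  With `W = γ ∪ α` and a dual path avoiding the open
  edges (hence `γ`), the last visit is on `α`, within `δ` of the landing point — the anchor of the
  closed arm of the printed proof.

## References

* O. Schramm, S. Smirnov, Ann. Probab. 39 (2011) 1768–1814, arXiv:1101.5820, proof of Lemma 6.1,
  case (2) (the region `M`). [SchrammSmirnov2011]
-/

noncomputable section

open scoped unitInterval
open Set Filter Metric Function
open _root_.Topology

namespace Literature.Probability.Percolation

namespace QuadCrossing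

variable {D : Set ℂ}

namespace Quad

variable {Q : Quad D} {W : Set ℂ}

/-! ### The region below `W` -/

/-- `W ∩ [Q]` lies below `W` (the constant path already meets `W`). [cite: SchrammSmirnov2011, proof of Lemma 6.1] -/
theorem subset_below (Q : Quad D) (W : Set ℂ) :
    W ∩ Q.carrier ⊆ {z | z ∈ Q.carrier ∧ ∀ t ∈ Q.side 3, ∀ p : Path z t,
      range p ⊆ Q.carrier → (range p ∩ W).Nonempty} :=
  fun z ⟨hzW, hzQ⟩ => ⟨hzQ, fun _ _ p _ => ⟨z, ⟨0, p.source⟩, hzW⟩⟩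

/-- **`∂₁Q` lies below `W`** when `W` is a compact connected subset of `[Q]` meeting `∂₀Q` and `∂₂Q`:
every path from `∂₁Q` to `∂₃Q` in `[Q]` meets `W` (crossing lemma).
[cite: SchrammSmirnov2011, proof of Lemma 6.1] -/
theorem side_one_subset_below (hWc : IsCompact W) (hWconn : IsPreconnected W) (hWsub : W ⊆ Q.carrier)
    (hW0 : (W ∩ Q.side 0).Nonempty) (hW2 : (W ∩ Q.side 2).Nonempty) :
    Q.side 1 ⊆ {z | z ∈ Q.carrier ∧ ∀ t ∈ Q.side 3, ∀ p : Path z t,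
      range p ⊆ Q.carrier → (range p ∩ W).Nonempty} := fun z hz => by
  refine ⟨Q.side_subset_carrier 1 hz, fun t ht p hp => ?_⟩
  obtain ⟨s, -, hs⟩ := Q.exists_mem_of_isPreconnected_crossing hWc hWconn hWsub hW0 hW2
    p.continuous_extend.continuousOn (fun s _ => hp ⟨projIcc 0 1 zero_le_one s, rfl⟩)
    (by rw [p.extend_zero]; exact hz) (by rw [p.extend_one]; exact ht)
  exact ⟨p.extend s, ⟨projIcc 0 1 zero_le_one s, rfl⟩, hs⟩

/-- A point of `[Q]` joined to `∂₃Q` by a path in `[Q]` off `W` is not below `W`; more generally no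
point of such a path is. [cite: SchrammSmirnov2011, proof of Lemma 6.1] -/
theorem not_mem_below_of_path_avoiding {z t : ℂ} (ht : t ∈ Q.side 3) (p : Path z t)
    (hp : range p ⊆ Q.carrier) (hpW : ∀ s, p s ∉ W) :
    z ∉ {z | z ∈ Q.carrier ∧ ∀ t ∈ Q.side 3, ∀ p : Path z t,
      range p ⊆ Q.carrier → (range p ∩ W).Nonempty} := by
  rintro ⟨-, h⟩
  obtain ⟨_, ⟨s, rfl⟩, hsW⟩ := h t ht p hp
  exact hpW s hsW

/-- **Short junctions do not change the region**: if `z` is below `W`, `w ∈ [Q]`, and some path in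
`[Q]` from `w` to `z` misses `W`, then `w` is below `W`. [cite: SchrammSmirnov2011, proof of Lemma 6.1] -/
theorem mem_below_of_path {z w : ℂ}
    (hz : z ∈ {z | z ∈ Q.carrier ∧ ∀ t ∈ Q.side 3, ∀ p : Path z t,
      range p ⊆ Q.carrier → (range p ∩ W).Nonempty})
    (hw : w ∈ Q.carrier) (q : Path w z) (hq : range q ⊆ Q.carrier) (hqW : ∀ s, q s ∉ W) :
    w ∈ {z | z ∈ Q.carrier ∧ ∀ t ∈ Q.side 3, ∀ p : Path z t,
      range p ⊆ Q.carrier → (range p ∩ W).Nonempty} := by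
  refine ⟨hw, fun t ht p hp => ?_⟩
  obtain ⟨y, hy, hyW⟩ := hz.2 t ht (q.symm.trans p)
    (by rw [Path.trans_range, Path.symm_range]; exact union_subset hq hp)
  rw [Path.trans_range, Path.symm_range] at hy
  rcases hy with ⟨s, rfl⟩ | hy
  · exact absurd hyW (hqW s)
  · exact ⟨y, hy, hyW⟩

/-- **The region below a closed `W` is closed.**  If `zₙ → z` with `zₙ` below `W` and `z ∉ W`, short
junctions from `zₙ` to `z` inside `[Q]` eventually miss the closed set `W`, so `z` is below `W`.
[cite: SchrammSmirnov2011, proof of Lemma 6.1] -/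
theorem isClosed_below (Q : Quad D) (hW : IsClosed W) :
    IsClosed {z | z ∈ Q.carrier ∧ ∀ t ∈ Q.side 3, ∀ p : Path z t,
      range p ⊆ Q.carrier → (range p ∩ W).Nonempty} := by
  refine isClosed_iff_clusterPt.2 fun z hz => ?_
  have hzcl : z ∈ closure {z | z ∈ Q.carrier ∧ ∀ t ∈ Q.side 3, ∀ p : Path z t,
      range p ⊆ Q.carrier → (range p ∩ W).Nonempty} := mem_closure_iff_clusterPt.2 hz
  have hzQ : z ∈ Q.carrier :=
    Q.isCompact_carrier.isClosed.closure_subset_iff.2 (fun w hw => hw.1) hzcl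
  by_cases hzW : z ∈ W
  · exact Q.subset_below W ⟨hzW, hzQ⟩
  -- room around `z` off `W`, and a short junction from a nearby point of the region
  obtain ⟨ε, hε, hball⟩ := Metric.isOpen_iff.1 hW.isOpen_compl z hzW
  obtain ⟨θ, hθ, hshort⟩ := Q.exists_short_path (half_pos hε)
  obtain ⟨z', hz'mem, hz'dist⟩ := Metric.mem_closure_iff.1 hzcl θ hθ
  obtain ⟨q, hq, hqdiam⟩ := hshort z hzQ z' hz'mem.1 hz'dist
  refine mem_below_of_path hz'mem hzQ q hq fun s hsW => ?_
  have hqs : dist (q s) z ≤ ε / 2 :=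
    (dist_le_diam_of_mem (isCompact_range q.continuous).isBounded ⟨s, rfl⟩ ⟨0, q.source⟩).trans hqdiam
  exact hball (mem_ball.2 (by linarith)) hsW

/-- **The boundary of the region inside `[Q]` lies on `W`.**  A point below `W` which is a limit of
points of `[Q]` not below `W` belongs to `W` (otherwise a short junction off `W` to such a point
would take it out of the region). [cite: SchrammSmirnov2011, proof of Lemma 6.1] -/
theorem mem_of_mem_below_of_mem_closure (hW : IsClosed W) {z : ℂ}
    (hz : z ∈ {z | z ∈ Q.carrier ∧ ∀ t ∈ Q.side 3, ∀ p : Path z t,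
      range p ⊆ Q.carrier → (range p ∩ W).Nonempty})
    (hzcl : z ∈ closure (Q.carrier \ {z | z ∈ Q.carrier ∧ ∀ t ∈ Q.side 3, ∀ p : Path z t,
      range p ⊆ Q.carrier → (range p ∩ W).Nonempty})) : z ∈ W := by
  by_contra hzW
  obtain ⟨ε, hε, hball⟩ := Metric.isOpen_iff.1 hW.isOpen_compl z hzW
  obtain ⟨θ, hθ, hshort⟩ := Q.exists_short_path (half_pos hε)
  obtain ⟨w, ⟨hwQ, hwnot⟩, hwdist⟩ := Metric.mem_closure_iff.1 hzcl θ hθ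
  obtain ⟨q, hq, hqdiam⟩ := hshort w hwQ z hz.1 (by rwa [dist_comm])
  refine hwnot (mem_below_of_path hz hwQ q hq fun s hsW => ?_)
  have hqs : dist (q s) z ≤ ε / 2 :=
    (dist_le_diam_of_mem (isCompact_range q.continuous).isBounded ⟨s, rfl⟩ ⟨1, q.target⟩).trans hqdiam
  exact hball (mem_ball.2 (by linarith)) hsW

/-! ### The last visit of a dual crossing to the region -/

/-- **A path to `∂₃Q` after its last visit to the region below `W`.**  Let `W ⊆ [Q]` be closed and let
`β` be a path in `[Q]` from a point below `W` to a point of `∂₃Q` not below `W` (e.g. off `W`).  Then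
there is a last time `s⋆ < 1` with `β s⋆` below `W`; `β s⋆ ∈ W`; and after `s⋆` the path avoids the
region below `W` (in particular `W`).  ("A dual closed crossing from `∂₃Q` to `(σ₃ ∩ M̄) ∪ ∂₁Q` …
inside `[Q] ∖ M`": with `W = γ ∪ α` for the lowest crossing `γ` — made of open edges, which a dual
path avoids — and its short junction `α` to `∂₂Q`, the last visit is on `α`.)
[cite: SchrammSmirnov2011, proof of Lemma 6.1, case (2)] -/
theorem exists_final_segment_avoiding_below (hW : IsClosed W) {β : ℝ → ℂ}
    (hβ : ContinuousOn β (Icc 0 1)) (hβQ : MapsTo β (Icc 0 1) Q.carrier)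
    (hβ0 : β 0 ∈ {z | z ∈ Q.carrier ∧ ∀ t ∈ Q.side 3, ∀ p : Path z t,
      range p ⊆ Q.carrier → (range p ∩ W).Nonempty})
    (hβ1 : β 1 ∉ {z | z ∈ Q.carrier ∧ ∀ t ∈ Q.side 3, ∀ p : Path z t,
      range p ⊆ Q.carrier → (range p ∩ W).Nonempty}) :
    ∃ s ∈ Ico (0 : ℝ) 1, β s ∈ W ∧
      ∀ u ∈ Ioc s 1, β u ∉ {z | z ∈ Q.carrier ∧ ∀ t ∈ Q.side 3, ∀ p : Path z t,
        range p ⊆ Q.carrier → (range p ∩ W).Nonempty} := by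
  set M : Set ℂ := {z | z ∈ Q.carrier ∧ ∀ t ∈ Q.side 3, ∀ p : Path z t,
      range p ⊆ Q.carrier → (range p ∩ W).Nonempty} with hM
  have hMc : IsClosed M := Q.isClosed_below hW
  set T : Set ℝ := {s | s ∈ Icc (0 : ℝ) 1 ∧ β s ∈ M} with hT
  have hTc : IsClosed T := hβ.preimage_isClosed_of_isClosed isClosed_Icc hMc
  have hTne : T.Nonempty := ⟨0, left_mem_Icc.2 zero_le_one, hβ0⟩
  have hTbdd : BddAbove T := ⟨1, fun s hs => hs.1.2⟩
  set s₀ := sSup T with hs₀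
  have hs₀T : s₀ ∈ T := hTc.csSup_mem hTne hTbdd
  have hs₀1 : s₀ < 1 := by
    rcases hs₀T.1.2.eq_or_lt with h | h
    · exact absurd (h ▸ hs₀T.2) hβ1
    · exact h
  have hafter : ∀ u ∈ Ioc s₀ 1, β u ∉ M := fun u hu huM =>
    (lt_irrefl _) (hu.1.trans_le (le_csSup hTbdd ⟨⟨hs₀T.1.1.trans hu.1.le, hu.2⟩, huM⟩))
  refine ⟨s₀, ⟨hs₀T.1.1, hs₀1⟩, ?_, hafter⟩
  -- `β s₀` is a limit of points of `[Q] ∖ M`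
  refine mem_of_mem_below_of_mem_closure hW hs₀T.2 ?_
  have hcont : ContinuousWithinAt β (Ioc s₀ 1) s₀ := (hβ s₀ hs₀T.1).mono fun u hu =>
    ⟨hs₀T.1.1.trans hu.1.le, hu.2⟩
  have hcl : s₀ ∈ closure (Ioc s₀ 1) := by
    rw [closure_Ioc hs₀1.ne]; exact left_mem_Icc.2 hs₀1.le
  refine closure_mono ?_ (hcont.mem_closure_image hcl)
  rintro _ ⟨u, hu, rfl⟩
  exact ⟨hβQ ⟨hs₀T.1.1.trans hu.1.le, hu.2⟩, hafter u hu⟩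

end Quad

end QuadCrossing

end Literature.Probability.Percolation
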